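import Summits.Ventures.QEC.Thresholds.ToricCodeThresholdKernelSymm
import Literature.InformationTheory.QuantumCodes.ToricCodePhenomenologicalAnisotropic
import Literature.InformationTheory.QuantumCodes.ToricCodeMatching
import HarnessLib

/-!
# Certified phenomenological toric thresholds with DIFFERENT qubit- and measurement-error rates `p ≠ q`:
# `Prob_fail(p, q) → 0` for `max(p, q) < p₀(μ')`, kernel decimal `max(p, q) ≤ .0111` — UNCONDITIONAL

Venture QEC, `Summits/Ventures/QEC/Thresholds/` (LADDER-QEC rung Q5, PARTITION row 09 "noise models … phenomenological";
qec-type-09 gen 4, item 09.ANISO). Every phenomenological threshold file of the tree so far treats the isotropic model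
`q = p` (the Q5 table's honest-limit line "p ≠ q … NOT covered"). The Literature file
`ToricCodePhenomenologicalAnisotropic.lean` PROVES Dennis–Kitaev–Landahl–Preskill's two-rate statement ("Provided that
`p̃ < (4μ₃²)⁻¹`, `q̃ < (4μ₃²)⁻¹` … `p, q < .0114`", §5.3 eqs. (threshold_iso), (threshold_iso_num)) for minimum-weight
space-time decoding, via the inhomogeneous half-density bound (`InhomogeneousDensityBound.lean`). This file draws the
certified consequences (all UNCONDITIONAL, tier CERTIFIED (kernel), axioms standard, 0 facts, 0 `native_decide`):

| theorem | statement (`T(L)` polynomially bounded; certified LOWER bounds on the threshold REGION) |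
|---|---|
| `phenom_aniso_belowThreshold_of_connectiveConstant_le` | symbolic: `μ(ℤ³) ≤ μ'`, `1 ≤ μ'`, every min-weight space-time decoder family, `0 ≤ p, q`, `max(p,q) < p₀(μ')` ⇒ `Prob_fail(p,q) → 0` |
| `phenom_aniso_belowThreshold_kernel` | the kernel bound `μ(ℤ³) ≤ 4.7599` (qec-type-03, symmetry-reduced memory-10 certificate): `max(p,q) < p₀(4.7599)` suffices |
| `phenom_aniso_belowThreshold_0111` | **decimal: `0 ≤ p ≤ .0111` and `0 ≤ q ≤ .0111` ⇒ `Prob_fail(p,q) → 0`** for every min-weight space-time decoder family |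
| `phenom_aniso_mwpm_belowThreshold_0111` | the same for every space-time MWPM decoder family (`ToricCodeMatching.lean`) |
| `phenom_aniso_failureProb_le_five` | finite size (DKLP eq. (fail_iso), elementary count `ν = 5`): `Prob_fail(p,q) ≤ 2L²(T+1)(6/5)(10s)^L/(5(1-10s))`, `s = √(ρ(1-ρ))`, `p, q ≤ ρ` |

HONEST FRAMING: the certified region is the SQUARE `max(p, q) < p₀`; DKLP's anisotropic decoder (links weighted by
`log((1-p)/p)`, `log((1-q)/q)`) would certify a larger region — not claimed. Printed `.0114` remains a CLAIM.

## References
* [DennisEtAl2002] E. Dennis, A. Kitaev, A. Landahl, J. Preskill, *Topological quantum memory*, J. Math. Phys. 43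
  (2002) 4452–4505, arXiv:quant-ph/0110143, §5.1 eq. (HV_prob), §5.3 eqs. (threshold_iso), (fail_iso), (threshold_iso_num).
-/

noncomputable section

namespace Summit.Ventures.QEC.Thresholds

open Filter Topology Finset
open Literature.InformationTheory.QuantumCodes
open Literature.InformationTheory.QuantumCodes.ToricCode
open Literature.Probability.RandomPlanarGeometry

/-- **Two-rate phenomenological threshold, symbolic form**: if `μ(ℤ³) ≤ μ'` (`1 ≤ μ'`), then for every polynomially
bounded schedule, every minimum-weight space-time decoder family and all `0 ≤ p, q` with `max(p, q) < p₀(μ')`, the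
failure probability `Prob_fail(p, q)` of the `(L+1) × (L+1)` toric codes tends to `0` — UNCONDITIONAL.
[cite: DennisEtAl2002, §5.3 eqs. (threshold_iso), (threshold_iso_num)] -/
theorem phenom_aniso_belowThreshold_of_connectiveConstant_le {μ' : ℝ} (hμ'1 : 1 ≤ μ')
    (hμ : SAW.Zd.connectiveConstant 3 ≤ μ') {T : ℕ → ℕ} (hT : IsPolyBounded T)
    {D : (L : ℕ) → STDecoder (L + 1) (T L)}
    (hD : ∀ L, (D L).IsMinWeight (stSyn (L + 1) (T L)) (stCycles (L + 1) (T L)) hammingNorm)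
    {p q : ℝ} (hp0 : 0 ≤ p) (hq0 : 0 ≤ q) (hpq : max p q < thresholdValue μ') :
    Tendsto (fun L => phenomFailureProb (L + 1) (T L) (D L) p q) atTop (𝓝 0) := by
  set ρ := max p q with hρ
  have hρ0 : 0 ≤ ρ := hp0.trans (le_max_left p q)
  have hρhalf : ρ ≤ 1 / 2 := hpq.le.trans (thresholdValue_le_half μ')
  have hlt : ρ * (1 - ρ) < thresholdValue μ' * (1 - thresholdValue μ') :=
    mul_one_sub_lt_mul_one_sub hpq (by linarith [thresholdValue_le_half μ'])
  have hμ'0 : 0 < μ' := lt_of_lt_of_le one_pos hμ'1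
  have h4 : 4 * μ' ^ 2 * (ρ * (1 - ρ)) < 1 := by
    calc 4 * μ' ^ 2 * (ρ * (1 - ρ)) < 4 * μ' ^ 2 * (thresholdValue μ' * (1 - thresholdValue μ')) := by
          gcongr
      _ = 1 := four_mul_sq_mul_thresholdValue hμ'1
  -- room to increase the base: choose `ν > μ'` with `4ν² ρ(1-ρ) < 1`
  have hρρ : 0 ≤ ρ * (1 - ρ) := mul_nonneg hρ0 (by linarith)
  obtain ⟨ν, hμν, h4ν⟩ : ∃ ν : ℝ, μ' < ν ∧ 4 * ν ^ 2 * (ρ * (1 - ρ)) < 1 := by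
    rcases hρρ.eq_or_lt with hz | hpos
    · exact ⟨μ' + 1, by linarith, by rw [← hz]; norm_num⟩
    · set x := ρ * (1 - ρ) with hx
      have hμx : μ' ^ 2 < 1 / (4 * x) := by
        rw [lt_div_iff₀ (by positivity)]; nlinarith
      set ν := Real.sqrt ((μ' ^ 2 + 1 / (4 * x)) / 2) with hν
      have hνsq : ν ^ 2 = (μ' ^ 2 + 1 / (4 * x)) / 2 := by
        rw [hν, Real.sq_sqrt (by positivity)]
      refine ⟨ν, ?_, ?_⟩
      · have : μ' ^ 2 < ν ^ 2 := by rw [hνsq]; linarith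
        exact lt_of_pow_lt_pow_left₀ 2 (Real.sqrt_nonneg _) this
      · have : ν ^ 2 < 1 / (4 * x) := by rw [hνsq]; linarith
        have hx4 : 0 < 4 * x := by positivity
        rw [lt_div_iff₀ hx4] at this
        linarith
  obtain ⟨C, hC⟩ := exists_sawCountBound3_of_connectiveConstant_lt (lt_of_le_of_lt hμ hμν)
  exact phenomThreshold_aniso_max (hμ'0.trans hμν) hC hT hD hp0 hq0 hρhalf h4ν

/-- **Two-rate phenomenological threshold from the kernel bound `μ(ℤ³) ≤ 4.7599`**: `max(p, q) < p₀(4.7599)` suffices,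
for every minimum-weight space-time decoder family — UNCONDITIONAL, tier CERTIFIED (kernel).
[cite: DennisEtAl2002, §5.3 eq. (threshold_iso_num)] -/
theorem phenom_aniso_belowThreshold_kernel {T : ℕ → ℕ} (hT : IsPolyBounded T)
    {D : (L : ℕ) → STDecoder (L + 1) (T L)}
    (hD : ∀ L, (D L).IsMinWeight (stSyn (L + 1) (T L)) (stCycles (L + 1) (T L)) hammingNorm)
    {p q : ℝ} (hp0 : 0 ≤ p) (hq0 : 0 ≤ q) (hpq : max p q < thresholdValue 4.7599) :
    Tendsto (fun L => phenomFailureProb (L + 1) (T L) (D L) p q) atTop (𝓝 0) :=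
  phenom_aniso_belowThreshold_of_connectiveConstant_le (by norm_num)
    SAW.Zd.FiniteMemory3.connectiveConstant_three_le_47599 hT hD hp0 hq0 hpq

/-- **Decimal form: `0 ≤ p ≤ .0111` and `0 ≤ q ≤ .0111` ⇒ `Prob_fail(p, q) → 0`** for every polynomially bounded
schedule and every minimum-weight space-time decoder family — UNCONDITIONAL, kernel (a certified LOWER bound on the
two-rate threshold region; printed `p, q < .0114` remains a CLAIM). [cite: DennisEtAl2002, §5.3 eq. (threshold_iso_num)] -/
theorem phenom_aniso_belowThreshold_0111 {T : ℕ → ℕ} (hT : IsPolyBounded T)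
    {D : (L : ℕ) → STDecoder (L + 1) (T L)}
    (hD : ∀ L, (D L).IsMinWeight (stSyn (L + 1) (T L)) (stCycles (L + 1) (T L)) hammingNorm)
    {p q : ℝ} (hp0 : 0 ≤ p) (hq0 : 0 ≤ q) (hp : p ≤ 0.0111) (hq : q ≤ 0.0111) :
    Tendsto (fun L => phenomFailureProb (L + 1) (T L) (D L) p q) atTop (𝓝 0) :=
  phenom_aniso_belowThreshold_kernel hT hD hp0 hq0
    (lt_of_le_of_lt (max_le hp hq) thresholdValue_47599_bounds.1)

/-- **The same for every space-time MWPM decoder family** (any admissible link metric on the space-time sites, any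
tie-break, any geodesics; `ToricCodeMatching.isMinWeight_of_isMatchingDecoder_st`): `p, q ≤ .0111 ⇒ Prob_fail(p,q) → 0`
— UNCONDITIONAL, kernel. [cite: DennisEtAl2002, §5.1 p. 19 and §5.3 eq. (threshold_iso_num)] -/
theorem phenom_aniso_mwpm_belowThreshold_0111 {T : ℕ → ℕ} (hT : IsPolyBounded T)
    (m : (L : ℕ) → EdgeMetric (stLinkEnds (L + 1) (T L))) {D : (L : ℕ) → STDecoder (L + 1) (T L)}
    (hD : ∀ L, IsMatchingDecoder (m L) (D L)) {p q : ℝ} (hp0 : 0 ≤ p) (hq0 : 0 ≤ q) (hp : p ≤ 0.0111)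
    (hq : q ≤ 0.0111) : Tendsto (fun L => phenomFailureProb (L + 1) (T L) (D L) p q) atTop (𝓝 0) :=
  phenom_aniso_belowThreshold_0111 hT (fun L => isMinWeight_of_isMatchingDecoder_st (hD L)) hp0 hq0 hp hq

/-- **Finite-size two-rate bound at DKLP's elementary cubic count** (`cₙ(ℤ³) ≤ (6/5)·5ⁿ`): for `L ≥ 3`, a minimum-weight
space-time decoder, `0 ≤ p, q ≤ ρ ≤ 1/2` and `s := √(ρ(1-ρ))` with `10s < 1`,
`Prob_fail(p, q) ≤ 2L²(T+1)·(6/5)·(10s)^L/(5(1-10s))`. UNCONDITIONAL, kernel.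
[cite: DennisEtAl2002, §5.3 eqs. (saw_d), (fail_iso)] -/
theorem phenom_aniso_failureProb_le_five (L T : ℕ) [NeZero L] (hL : 3 ≤ L) {D : STDecoder L T}
    (hD : D.IsMinWeight (stSyn L T) (stCycles L T) hammingNorm) {p q ρ : ℝ} (hp0 : 0 ≤ p) (hq0 : 0 ≤ q)
    (hpρ : p ≤ ρ) (hqρ : q ≤ ρ) (hρ : ρ ≤ 1 / 2) (hs : 10 * Real.sqrt (ρ * (1 - ρ)) < 1) :
    phenomFailureProb L T D p q ≤
      2 * (L : ℝ) ^ 2 * ((T : ℝ) + 1) * (6 / 5) * (2 * 5 * Real.sqrt (ρ * (1 - ρ))) ^ L /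
        (5 * (1 - 2 * 5 * Real.sqrt (ρ * (1 - ρ)))) :=
  phenomFailureProb_le_aniso (by norm_num) sawCountBound3_five L T hL D hD hp0 hq0 hpρ hqρ hρ (by linarith)

end Summit.Ventures.QEC.Thresholds

end
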